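import Literature.AlgebraicGeometry.Resolution.LogRegularEtaleResolution
import Literature.AlgebraicGeometry.Resolution.LogRegularEtaleAffinePieces
import Mathlib.AlgebraicGeometry.Morphisms.Etale
import Mathlib.AlgebraicGeometry.Morphisms.QuasiSeparated
import Mathlib.AlgebraicGeometry.Noetherian
import HarnessLib

/-!
# Resolution of a quasi-compact log regular scheme with étale charts: Nizioł 2006, Cor. 5.7
# (ÉTALE KATO programme, blocks EK-0′ and EK-8 — the discharge)

Topic: `Literature/AlgebraicGeometry/Resolution`. The named fact
`Niziol2006_logRegularScheme_hasResolution` (`LogRegularSchemeEtale.lean`; consumer: crux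
`CoverResolution`, `stub_logRegularResolution`) is PROVED:

* `EtaleLogAtlas.sup_map_chartStalkMonoid_eq` — the log structure of an étale atlas is well
  defined on any `X`-scheme: for `a : W → U_i`, `b : W → U_j` over `X` and `w ∈ W` the stalk
  monoids `𝒪_w^× · a_w^*(φ_i(P_i))` and `𝒪_w^× · b_w^*(φ_j(P_j))` agree (Kato's compatibility on
  `U_i ×_X U_j`, Nizioł §2.1, transported along `W → U_i ×_X U_j`);
* `EtaleLogAtlas.IsLogRegular.hasResolution_of_small_index` (EK-0′): a quasi-compact log regular
  `X` (index type in `Type`) carries affine étale pieces (`LogRegularAtlas.EtalePieces`, EK-3a) —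
  finitely many affine opens `V` of the chart domains `U_i` covering `X`
  (`exists_finset_affineOpens_cover`, EK-0), structure maps `V ↪ U_i → X`, charts `φ_i|_V`, log
  regular at every prime by the étale-local nature of (2.1) (`isLogRegularLocal_comp_stalkMap_iff`,
  EK-1) — hence a resolution (`EtalePieces.hasResolution`, EK-7);
* `Niziol2006_logRegularScheme_hasResolution_holds` — the fact, after reindexing the atlas by
  `Fin n`.

References: [Niziol2006] §2.1–2.2, Cor. 5.7; [Kato1994] (1.5)–(1.8), (10.4).
-/

noncomputable section

open AlgebraicGeometry CategoryTheory CategoryTheory.Limits TopologicalSpace Opposite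

namespace Literature.AlgebraicGeometry.Resolution

universe u w

/-! ## Stalk monoids of charts pulled back in two steps -/

/-- **Stalk monoid of a chart pulled back in two steps**: for `f : W → Y'`, `ι : Y' → Y` and a
chart `φ : P → Γ(Y, 𝒪)`, the submonoid `𝒪_w^× · f_w^*((ι^*φ)~_{f w})` of `𝒪_{W,w}` generated by the
units and the pulled-back stalk monoid of `ι^* φ` equals `𝒪_w^× · (f ≫ ι)_w^*(φ~_{ι f w})`.
[cite: Kato1994, (1.5)–(1.6)] -/
theorem sup_map_chartStalkMonoid_appLE_comp {W Y' Y : Scheme.{u}} (f : W ⟶ Y') (ι' : Y' ⟶ Y)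
    {P : Type*} [MulOneClass P] (φ : P →* Γ(Y, ⊤)) (hle : (⊤ : Y'.Opens) ≤ ι' ⁻¹ᵁ ⊤) (w : W) :
    IsUnit.submonoid (W.presheaf.stalk w) ⊔
        (chartStalkMonoid ⊤ ((ι'.appLE ⊤ ⊤ hle).hom.toMonoidHom.comp φ) (f.base w) trivial).map
          (f.stalkMap w).hom.toMonoidHom =
      IsUnit.submonoid (W.presheaf.stalk w) ⊔
        (chartStalkMonoid ⊤ φ ((f ≫ ι').base w) trivial).map
          ((f ≫ ι').stalkMap w).hom.toMonoidHom := by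
  rw [chartStalkMonoid_appLE_eq, Submonoid.map_sup, ← sup_assoc]
  have hu : IsUnit.submonoid (W.presheaf.stalk w) ⊔
      (IsUnit.submonoid (Y'.presheaf.stalk (f.base w))).map (f.stalkMap w).hom.toMonoidHom =
      IsUnit.submonoid (W.presheaf.stalk w) := by
    refine sup_eq_left.2 ?_
    rintro _ ⟨v, hv, rfl⟩
    exact (IsUnit.mem_submonoid_iff _).2 (((IsUnit.mem_submonoid_iff _).1 hv).map _)
  rw [hu, Submonoid.map_map, Scheme.Hom.stalkMap_comp]
  rfl

namespace EtaleLogAtlas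

variable {X : Scheme.{u}} (𝒜 : EtaleLogAtlas.{w} X)

/-! ## The log structure of an étale atlas on an `X`-scheme -/

/-- Kato's compatibility transported along `g : W → U_i ×_X U_j`: the germ `(g ≫ pr₁)_w^*(φ_i(p))`
is associated in `𝒪_{W,w}` to some `(g ≫ pr₂)_w^*(φ_j(q))`. [cite: Niziol2006, §2.1]
[cite: Kato1994, (1.5) and (1.8)] -/
theorem exists_associated_stalkMap_stalkChart (i j : 𝒜.ι) {W : Scheme.{u}}
    (g : W ⟶ pullback (𝒜.map i) (𝒜.map j)) (w : W) (p : 𝒜.P i) :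
    ∃ q : 𝒜.P j, Associated
      (((g ≫ pullback.fst (𝒜.map i) (𝒜.map j)).stalkMap w).hom
        (𝒜.stalkChart i ((g ≫ pullback.fst (𝒜.map i) (𝒜.map j)).base w)
          (Multiplicative.ofAdd p)))
      (((g ≫ pullback.snd (𝒜.map i) (𝒜.map j)).stalkMap w).hom
        (𝒜.stalkChart j ((g ≫ pullback.snd (𝒜.map i) (𝒜.map j)).base w)
          (Multiplicative.ofAdd q))) := by
  obtain ⟨q, hq⟩ := 𝒜.chart_compatible i j (g.base w) p
  rw [germ_fst_appTop, germ_snd_appTop] at hq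
  refine ⟨q, ?_⟩
  have e1 : ((g ≫ pullback.fst (𝒜.map i) (𝒜.map j)).stalkMap w).hom
      (𝒜.stalkChart i ((g ≫ pullback.fst (𝒜.map i) (𝒜.map j)).base w)
        (Multiplicative.ofAdd p)) =
      (g.stalkMap w).hom (((pullback.fst (𝒜.map i) (𝒜.map j)).stalkMap (g.base w)).hom
        (𝒜.stalkChart i ((pullback.fst (𝒜.map i) (𝒜.map j)).base (g.base w))
          (Multiplicative.ofAdd p))) := by
    rw [Scheme.Hom.stalkMap_comp]
    rfl
  have e2 : ((g ≫ pullback.snd (𝒜.map i) (𝒜.map j)).stalkMap w).hom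
      (𝒜.stalkChart j ((g ≫ pullback.snd (𝒜.map i) (𝒜.map j)).base w)
        (Multiplicative.ofAdd q)) =
      (g.stalkMap w).hom (((pullback.snd (𝒜.map i) (𝒜.map j)).stalkMap (g.base w)).hom
        (𝒜.stalkChart j ((pullback.snd (𝒜.map i) (𝒜.map j)).base (g.base w))
          (Multiplicative.ofAdd q))) := by
    rw [Scheme.Hom.stalkMap_comp]
    rfl
  rw [e1, e2]
  exact hq.map (g.stalkMap w).hom

/-- **The log structure of an étale atlas is well defined on `X`-schemes (inclusion)**: for
`a : W → U_i` and `b : W → U_j` with `a ≫ map i = b ≫ map j` and `w ∈ W`,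
`𝒪_w^× · a_w^*(φ_i(P_i)) ⊆ 𝒪_w^× · b_w^*(φ_j(P_j))` in `𝒪_{W,w}` (through
`W → U_i ×_X U_j`). [cite: Niziol2006, §2.1] [cite: Kato1994, (1.5) and (1.8)] -/
theorem sup_map_chartStalkMonoid_le (i j : 𝒜.ι) {W : Scheme.{u}} (a : W ⟶ 𝒜.U i)
    (b : W ⟶ 𝒜.U j) (h : a ≫ 𝒜.map i = b ≫ 𝒜.map j) (w : W) :
    IsUnit.submonoid (W.presheaf.stalk w) ⊔
        (chartStalkMonoid ⊤ (𝒜.chart i) (a.base w) trivial).map (a.stalkMap w).hom.toMonoidHom ≤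
      IsUnit.submonoid (W.presheaf.stalk w) ⊔
        (chartStalkMonoid ⊤ (𝒜.chart j) (b.base w) trivial).map
          (b.stalkMap w).hom.toMonoidHom := by
  have key : ∀ g : W ⟶ pullback (𝒜.map i) (𝒜.map j),
      IsUnit.submonoid (W.presheaf.stalk w) ⊔
          (chartStalkMonoid ⊤ (𝒜.chart i) ((g ≫ pullback.fst (𝒜.map i) (𝒜.map j)).base w)
            trivial).map ((g ≫ pullback.fst (𝒜.map i) (𝒜.map j)).stalkMap w).hom.toMonoidHom ≤
        IsUnit.submonoid (W.presheaf.stalk w) ⊔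
          (chartStalkMonoid ⊤ (𝒜.chart j) ((g ≫ pullback.snd (𝒜.map i) (𝒜.map j)).base w)
            trivial).map ((g ≫ pullback.snd (𝒜.map i) (𝒜.map j)).stalkMap w).hom.toMonoidHom := by
    intro g
    refine sup_le le_sup_left ?_
    rintro _ ⟨m, hm, rfl⟩
    obtain ⟨y, hy, z, hz, rfl⟩ := Submonoid.mem_sup.1 hm
    obtain ⟨_, ⟨p, rfl⟩, rfl⟩ := hz
    rw [map_mul]
    refine Submonoid.mul_mem _ (Submonoid.mem_sup_left ((IsUnit.mem_submonoid_iff _).2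
      (((IsUnit.mem_submonoid_iff _).1 hy).map _))) ?_
    obtain ⟨q, u, hu⟩ :=
      𝒜.exists_associated_stalkMap_stalkChart i j g w (Multiplicative.toAdd p)
    have hrew : ((g ≫ pullback.fst (𝒜.map i) (𝒜.map j)).stalkMap w).hom.toMonoidHom
        ((((𝒜.U i).presheaf.germ ⊤ ((g ≫ pullback.fst (𝒜.map i) (𝒜.map j)).base w)
          trivial).hom.toMonoidHom) (𝒜.chart i p)) =
        ((g ≫ pullback.snd (𝒜.map i) (𝒜.map j)).stalkMap w).hom
            (𝒜.stalkChart j ((g ≫ pullback.snd (𝒜.map i) (𝒜.map j)).base w)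
              (Multiplicative.ofAdd q)) * (↑u⁻¹ : W.presheaf.stalk w) := by
      rw [Units.eq_mul_inv_iff_mul_eq]
      exact hu
    rw [hrew]
    exact Submonoid.mul_mem _
      (Submonoid.mem_sup_right ⟨_, Submonoid.mem_sup_right ⟨_, ⟨Multiplicative.ofAdd q, rfl⟩, rfl⟩,
        rfl⟩)
      (Submonoid.mem_sup_left ((IsUnit.mem_submonoid_iff _).2 (Units.isUnit u⁻¹)))
  have key' := key (pullback.lift a b h)
  rw [pullback.lift_fst, pullback.lift_snd] at key'
  exact key'

/-- **The log structure of an étale atlas is well defined on `X`-schemes**: for `a : W → U_i`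
and `b : W → U_j` over `X` (`a ≫ map i = b ≫ map j`) and `w ∈ W`, the submonoids
`𝒪_w^× · a_w^*(φ_i(P_i))` and `𝒪_w^× · b_w^*(φ_j(P_j))` of `𝒪_{W,w}` coincide (the stalk at `w`
of the pulled-back log structure). [cite: Niziol2006, §2.1] [cite: Kato1994, (1.5) and (1.8)] -/
theorem sup_map_chartStalkMonoid_eq (i j : 𝒜.ι) {W : Scheme.{u}} (a : W ⟶ 𝒜.U i)
    (b : W ⟶ 𝒜.U j) (h : a ≫ 𝒜.map i = b ≫ 𝒜.map j) (w : W) :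
    IsUnit.submonoid (W.presheaf.stalk w) ⊔
        (chartStalkMonoid ⊤ (𝒜.chart i) (a.base w) trivial).map (a.stalkMap w).hom.toMonoidHom =
      IsUnit.submonoid (W.presheaf.stalk w) ⊔
        (chartStalkMonoid ⊤ (𝒜.chart j) (b.base w) trivial).map
          (b.stalkMap w).hom.toMonoidHom :=
  le_antisymm (𝒜.sup_map_chartStalkMonoid_le i j a b h w)
    (𝒜.sup_map_chartStalkMonoid_le j i b a h.symm w)

/-! ## Affine étale pieces of a quasi-compact log regular scheme (EK-0′) -/

/-- On an affine open, every prime ideal of the ring of sections is the prime of a point.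
[folklore] -/
private theorem exists_primeIdealOf_eq' {Y : Scheme.{u}} {V : Y.Opens} (hV : IsAffineOpen V)
    (𝔭 : Ideal Γ(Y, V)) [𝔭.IsPrime] : ∃ y : V, hV.primeIdealOf y = ⟨𝔭, inferInstance⟩ :=
  ⟨⟨hV.fromSpec ⟨𝔭, inferInstance⟩, hV.range_fromSpec.le ⟨_, rfl⟩⟩, by
    apply hV.fromSpec.isOpenEmbedding.injective
    rw [hV.fromSpec_primeIdealOf]⟩

/-- **The restricted chart of an affine open `V ⊆ U_i` is log regular at every prime of
`Γ(V, 𝒪_V)`** (pass to the point `y`, `LogChart.isLogRegularAt_primeIdealOf_iff`, then along the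
open immersion `V ↪ U_i` by the étale-local nature of Kato's (2.1),
`LogChart.isLogRegularLocal_comp_stalkMap_iff`). [cite: Niziol2006, Def. 2.2 and Lemma 2.3]
[cite: Kato1994, Def. (2.1)] -/
theorem IsLogRegular.isLogRegularAt_appLE_chart {𝒜 : EtaleLogAtlas.{w} X} (h : 𝒜.IsLogRegular)
    (i : 𝒜.ι) (V : (𝒜.U i).affineOpens)
    (𝔭 : Ideal Γ(((V : (𝒜.U i).Opens) : Scheme.{u}), ⊤)) [𝔭.IsPrime] :
    LogChart.IsLogRegularAt (𝒜.P i)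
      ((((V : (𝒜.U i).Opens).ι.appLE ⊤ ⊤ le_top).hom.toMonoidHom.comp (𝒜.chart i))) 𝔭 := by
  haveI := h.isLocallyNoetherian
  haveI : IsLocallyNoetherian (𝒜.U i) := h.isLocallyNoetherian_U i
  haveI : IsAffine ((V : (𝒜.U i).Opens) : Scheme.{u}) := V.2
  obtain ⟨⟨y, hy⟩, hyp⟩ := exists_primeIdealOf_eq' (isAffineOpen_top _) 𝔭
  have key : LogChart.IsLogRegularAt (𝒜.P i)
      ((((V : (𝒜.U i).Opens).ι.appLE ⊤ ⊤ le_top).hom.toMonoidHom.comp (𝒜.chart i)))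
      ((isAffineOpen_top _).primeIdealOf ⟨y, hy⟩).asIdeal := by
    rw [LogChart.isLogRegularAt_primeIdealOf_iff]
    have hc : (((V : (𝒜.U i).Opens) : Scheme.{u}).presheaf.germ ⊤ y hy).hom.toMonoidHom.comp
        ((((V : (𝒜.U i).Opens).ι.appLE ⊤ ⊤ le_top).hom.toMonoidHom.comp (𝒜.chart i))) =
        ((V : (𝒜.U i).Opens).ι.stalkMap y).hom.toMonoidHom.comp
          (𝒜.stalkChart i ((V : (𝒜.U i).Opens).ι.base y)) :=
      MonoidHom.ext fun p => germ_appLE_eq_stalkMap _ ⊤ ⊤ le_top y hy (𝒜.chart i p)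
    rw [hc]
    exact (LogChart.isLogRegularLocal_comp_stalkMap_iff (V : (𝒜.U i).Opens).ι y (𝒜.P i)
      (𝒜.stalkChart i ((V : (𝒜.U i).Opens).ι.base y))).2 (h.isLogRegularLocal i _)
  rw [hyp] at key
  exact key

/-- **The restricted charts of two affine pieces `V ⊆ U_i`, `V' ⊆ U_{i'}` define the same log
structure on `V ×_X V'`**: at every point the pulled-back stalk monoids, together with the units,
agree (`sup_map_chartStalkMonoid_eq` for `pr₁ ≫ ι_V`, `pr₂ ≫ ι_{V'}`). [cite: Niziol2006, §2.1]
[cite: Kato1994, (1.5) and (1.8)] -/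
theorem sup_map_chartStalkMonoid_pieces_eq (i i' : 𝒜.ι) (V : (𝒜.U i).Opens)
    (V' : (𝒜.U i').Opens) (z : ↥(pullback (V.ι ≫ 𝒜.map i) (V'.ι ≫ 𝒜.map i'))) :
    IsUnit.submonoid ((pullback (V.ι ≫ 𝒜.map i) (V'.ι ≫ 𝒜.map i')).presheaf.stalk z) ⊔
        (chartStalkMonoid ⊤ ((V.ι.appLE ⊤ ⊤ le_top).hom.toMonoidHom.comp (𝒜.chart i))
          ((pullback.fst (V.ι ≫ 𝒜.map i) (V'.ι ≫ 𝒜.map i')).base z) trivial).map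
          ((pullback.fst (V.ι ≫ 𝒜.map i) (V'.ι ≫ 𝒜.map i')).stalkMap z).hom.toMonoidHom =
      IsUnit.submonoid ((pullback (V.ι ≫ 𝒜.map i) (V'.ι ≫ 𝒜.map i')).presheaf.stalk z) ⊔
        (chartStalkMonoid ⊤ ((V'.ι.appLE ⊤ ⊤ le_top).hom.toMonoidHom.comp (𝒜.chart i'))
          ((pullback.snd (V.ι ≫ 𝒜.map i) (V'.ι ≫ 𝒜.map i')).base z) trivial).map
          ((pullback.snd (V.ι ≫ 𝒜.map i) (V'.ι ≫ 𝒜.map i')).stalkMap z).hom.toMonoidHom := by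
  rw [sup_map_chartStalkMonoid_appLE_comp, sup_map_chartStalkMonoid_appLE_comp]
  exact 𝒜.sup_map_chartStalkMonoid_eq i i' _ _
    (by rw [Category.assoc, Category.assoc]; exact pullback.condition) z

/-- **A quasi-compact log regular scheme with étale charts has a resolution of singularities**
(index type of the atlas in `Type`; Nizioł 2006 Cor. 5.7 via Kato 1994 (10.4) on étale charts):
`X` carries affine étale pieces in the sense of `LogRegularAtlas.EtalePieces` — finitely many
affine opens `V` of the chart domains covering `X` (EK-0), structure maps `V ↪ U_i → X` (étale,
quasi-compact as `X` is locally Noetherian), charts `φ_i|_V`, log regular at every prime of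
`Γ(V, 𝒪)` (`IsLogRegular.isLogRegularAt_appLE_chart`), compatible on the fibre products
(`sup_map_chartStalkMonoid_pieces_eq`) — and `EtalePieces.hasResolution` (EK-7) applies.
[cite: Niziol2006, Cor. 5.7] [cite: Kato1994, (10.4)] -/
theorem IsLogRegular.hasResolution_of_small_index [CompactSpace X] {𝒜 : EtaleLogAtlas.{0} X}
    (h : 𝒜.IsLogRegular) : Scheme.HasResolution X := by
  classical
  obtain ⟨t, ht⟩ := 𝒜.exists_finset_affineOpens_cover
  haveI := h.isLocallyNoetherian
  haveI hUN : ∀ i, IsLocallyNoetherian (𝒜.U i) := h.isLocallyNoetherian_U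
  refine LogRegularAtlas.EtalePieces.hasResolution
    (M := ⟨𝒜.ι, inferInstance, 𝒜.rk, 𝒜.P, 𝒜.fg, 𝒜.saturated', 𝒜.span_eq_top⟩)
    { κ := Fin t.card
      fintype := inferInstance
      V := fun k => (((t.equivFin.symm k).1.2 : (𝒜.U (t.equivFin.symm k).1.1).Opens) :
        Scheme.{u})
      affine := fun k => (t.equivFin.symm k).1.2.2
      e := fun k => ((t.equivFin.symm k).1.2 : (𝒜.U (t.equivFin.symm k).1.1).Opens).ι ≫
        𝒜.map (t.equivFin.symm k).1.1
      flat := fun k => inferInstance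
      unramified := fun k => inferInstance
      lft := fun k => inferInstance
      quasiCompact := fun k => by
        haveI : IsAffine (((t.equivFin.symm k).1.2 : (𝒜.U (t.equivFin.symm k).1.1).Opens) :
          Scheme.{u}) := (t.equivFin.symm k).1.2.2
        infer_instance
      surj := fun x => by
        obtain ⟨s, hs, v, hv, hx⟩ := ht x
        obtain ⟨k, hk⟩ : ∃ k : Fin t.card, (t.equivFin.symm k).1 = s :=
          ⟨t.equivFin ⟨s, hs⟩, by rw [Equiv.symm_apply_apply]⟩
        subst hk
        exact ⟨k, ⟨v, hv⟩, by rw [Scheme.Hom.comp_apply]; exact hx⟩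
      idx := fun k => (t.equivFin.symm k).1.1
      isNoetherianRing := fun k => IsLocallyNoetherian.component_noetherian
        (⟨⊤, isAffineOpen_top _⟩ : Scheme.affineOpens _)
      φ := fun k => (((t.equivFin.symm k).1.2 : (𝒜.U (t.equivFin.symm k).1.1).Opens).ι.appLE
        ⊤ ⊤ le_top).hom.toMonoidHom.comp (𝒜.chart (t.equivFin.symm k).1.1)
      isLogRegularAt := fun k 𝔭 _ => h.isLogRegularAt_appLE_chart _ (t.equivFin.symm k).1.2 𝔭
      compat := fun k k' z => 𝒜.sup_map_chartStalkMonoid_pieces_eq _ _ _ _ z }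

end EtaleLogAtlas

/-! ## The discharge -/

/-- **Nizioł 2006, Cor. 5.7 (weak form of the tree) holds**: a quasi-compact log regular scheme
with fs charts on the étale site admits a resolution of singularities (reindex the atlas by
`Fin n`, then `EtaleLogAtlas.IsLogRegular.hasResolution_of_small_index`).
[cite: Niziol2006, Cor. 5.7] [cite: Kato1994, (10.4)] -/
theorem Niziol2006_logRegularScheme_hasResolution_holds :
    Niziol2006_logRegularScheme_hasResolution.{u} := by
  intro X 𝒜 hX h𝒜
  obtain ⟨n, ⟨e⟩⟩ := Finite.exists_equiv_fin 𝒜.ι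
  exact (h𝒜.reindex e.symm).hasResolution_of_small_index

end Literature.AlgebraicGeometry.Resolution

end
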